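import Summits.ResolutionOfSingularities.ResolutionOfSingularities.Theorems.WildConesCampaignW46ForcedAtomRegime
import Summits.ResolutionOfSingularities.ResolutionOfSingularities.Theorems.WildConesCampaignW46ForcedAtomIsolTransfer
import HarnessLib

/-!
# [OURS · L1 W4.6, rung (i)/(all `n ≥ 1`)] The typed Th. 16.6 procedure terminates in the forced-atom class in its
# EXISTENTIAL form — «SOME presentation by an isolated atom» suffices
# (cell res-hironaka, LADDER-RESOLUTION rung L, D-0089; slot W4.6, seat res-L1-s46-pv-2 gen 3; host route `WildCones`,
# crux `ClassicalRegimes` stmt-ResolutionOfSingularities-16884, `--supports … --as helper`)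

HONEST FRAMING. Everything here is OURS. NOTHING below is a statement of H. Hironaka's manuscript [Hironaka2017] and
nothing asserts that any statement of it holds: the typed procedure (`CampaignW46.Run`/`Terminates`/`Regime`,
res-L1-type-o1) and the typed candidate carriers enter as DEFINITIONS; no FACT-LIST premise is used. AI review is weaker
than expert review.

## What is proved (closing the «NOT COVERED» item «Tjurina invariance under non-`K`-linear ring automorphisms» of p516034)

The rung `CampaignW46.ForcedAtom.terminates_of_le_forcedAtom` (p516034) — and the named regime `CampaignW46.Regime.forcedAtom`
typed from it verbatim by res-L1-type-o1 (p517839) — carry the clause «EVERY formal presentation `E₀(f₀) = w₀·(z^p − ser c₀)`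
of `J_ξ` has `Isol c₀`», because presentations are RING isomorphisms `𝒪̂_{Z,ξ} ≃+* K⟦z,u⟧` and brick 11 covered only
`K`-algebra coordinate changes. With brick 14 (`…TjurinaInvarianceRing.lean`, p517877: over a PERFECT field every ring
automorphism of `K⟦X⟧` is semilinear, so the Tjurina algebra is intrinsic under ring automorphisms) and brick 15
(`…ForcedAtomIsolTransfer.lean`: `isol_iff_isol_of_span_eq`) the universal clause follows from the existential one:

* `CampaignW46.Regime.forcedAtom_of_exists` / `CampaignW46.Regime.forcedAtom_iff_exists` — over a PERFECT field `K` of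
  characteristic `p`, the named regime `Regime.forcedAtom n` (res-L1-type-o1, p517839) EQUALS its existential form:
  `E.b = p`; `Sing(E)` at most one point; at `ξ ∈ Sing(E)`: embedding dimension `n + 1` and SOME presentation
  `(E₀, f₀, c₀, w₀)` of `J_ξ` by a unit times `z^p − ser c₀` with `Isol c₀` — the clause «every presentation is
  isolated» is REDUNDANT (so the typer's VACUITY remark (a) of p517839 no longer needs the «NOT COVERED» caveat);
* `CampaignW46.ForcedAtom.terminates_of_le_forcedAtomExists` — `K` algebraically closed of characteristic `p`, `0 < n`:
  every regime contained in the existential forced-atom class is terminating for the typed procedure (`Terminates`),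
  and `terminatesNabla_of_le_forcedAtomExists` (∇-centred); through o1's `forcedAtomTerminates_holds` /
  `terminates_of_le_regime_forcedAtom`.

NOT claimed: `n = 0`; perfect non-closed `K` for the termination (the regime identity holds over every perfect field).
References: this seat's bricks 14, 15 and p516034; p517839 (res-L1-type-o1). [folklore]
-/

noncomputable section

-- single-problem summit: the doubled namespace component `ResolutionOfSingularities` is forced
set_option linter.dupNamespace false

open MvPowerSeries IsLocalRing

namespace Summit.ResolutionOfSingularities.ResolutionOfSingularities.Theorems

namespace CampaignW46

open CategoryTheory AlgebraicGeometry TopologicalSpace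
open Literature.AlgebraicGeometry.Resolution
open Literature.AlgebraicGeometry.Hironaka2017.S02Preliminaries
open Literature.AlgebraicGeometry.Hironaka2017.Datum
open Scheme.IdealSheafData
open WildCones CampaignW46.AtomGerm

variable {p : ℕ} [Fact p.Prime] {K : Type} [Field K] [CharP K p] {n : ℕ}

/-- [OURS · L1 W4.6; NOT a statement of the manuscript] **«Some presentation isolated» puts a state in the named
forced-atom regime.** Over a perfect field `K` of characteristic `p`: if a state `(A, E)` of the typed procedure has
`E.b = p`, `Sing(E)` a subsingleton, and at every `ξ ∈ Sing(E)` embedding dimension `n + 1` and SOME presentation of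
`J_ξ` by a unit times an atom `z^p − ser c₀` with `Isol c₀`, then `Regime.forcedAtom n A E` (p517839, whose last clause
asks `Isol` of EVERY presentation) — by brick 15 `isol_iff_isol_of_span_eq`. [folklore] -/
theorem Regime.forcedAtom_of_exists [PerfectRing K p] (A : AmbientDatum p K) (E : IdealExponent A.Z)
    (h : E.b = p ∧ E.sing.Subsingleton ∧ ∀ ξ ∈ E.sing,
      (maximalIdeal (A.Z.presheaf.stalk ξ)).spanFinrank = n + 1 ∧
      ∃ (E₀ : AdicCompletion (maximalIdeal (A.Z.presheaf.stalk ξ)) (A.Z.presheaf.stalk ξ) ≃+*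
          MvPowerSeries (Option (Fin n)) K)
        (f₀ : A.Z.presheaf.stalk ξ) (c₀ : (Fin n → ℕ) → K) (w₀ : MvPowerSeries (Option (Fin n)) K),
        stalkIdeal E.J ξ = Ideal.span {f₀} ∧ IsUnit w₀ ∧
          E₀ (algebraMap _ _ f₀) = w₀ * ((X none : MvPowerSeries (Option (Fin n)) K) ^ p -
            rename (some : Fin n → Option (Fin n)) (ser p n K c₀)) ∧ Isol p n K c₀) :
    Regime.forcedAtom (p := p) (K := K) n A E := by
  refine ⟨h.1, h.2.1, fun ξ hξ => ?_⟩
  obtain ⟨hd, E₀, f₀, c₀, w₀, hJ, hw₀, hf₀, hI⟩ := h.2.2 ξ hξ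
  refine ⟨hd, ⟨E₀, f₀, c₀, w₀, hJ, hw₀, hf₀⟩, fun E₀' f₀' c₀' w₀' hJ' hw₀' hf₀' => ?_⟩
  exact (isol_iff_isol_of_span_eq E₀ E₀' f₀ f₀' c₀ c₀' w₀ w₀' (hJ.symm.trans hJ') hw₀ hw₀' hf₀ hf₀').mp hI

/-- [OURS · L1 W4.6; NOT a statement of the manuscript] **The named forced-atom regime equals its existential form**
over a perfect field of characteristic `p`: the clause «every presentation is isolated» of `Regime.forcedAtom`
(p517839) is redundant. [folklore] -/
theorem Regime.forcedAtom_iff_exists [PerfectRing K p] (A : AmbientDatum p K) (E : IdealExponent A.Z) :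
    Regime.forcedAtom (p := p) (K := K) n A E ↔
      E.b = p ∧ E.sing.Subsingleton ∧ ∀ ξ ∈ E.sing,
        (maximalIdeal (A.Z.presheaf.stalk ξ)).spanFinrank = n + 1 ∧
        ∃ (E₀ : AdicCompletion (maximalIdeal (A.Z.presheaf.stalk ξ)) (A.Z.presheaf.stalk ξ) ≃+*
            MvPowerSeries (Option (Fin n)) K)
          (f₀ : A.Z.presheaf.stalk ξ) (c₀ : (Fin n → ℕ) → K) (w₀ : MvPowerSeries (Option (Fin n)) K),
          stalkIdeal E.J ξ = Ideal.span {f₀} ∧ IsUnit w₀ ∧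
            E₀ (algebraMap _ _ f₀) = w₀ * ((X none : MvPowerSeries (Option (Fin n)) K) ^ p -
              rename (some : Fin n → Option (Fin n)) (ser p n K c₀)) ∧ Isol p n K c₀ := by
  refine ⟨fun h => ⟨h.1, h.2.1, fun ξ hξ => ?_⟩, Regime.forcedAtom_of_exists A E⟩
  obtain ⟨hd, ⟨E₀, f₀, c₀, w₀, hJ, hw₀, hf₀⟩, hall⟩ := h.2.2 ξ hξ
  exact ⟨hd, E₀, f₀, c₀, w₀, hJ, hw₀, hf₀, hall E₀ f₀ c₀ w₀ hJ hw₀ hf₀⟩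

end CampaignW46

namespace CampaignW46.ForcedAtom

open CategoryTheory AlgebraicGeometry TopologicalSpace
open Literature.AlgebraicGeometry.Resolution
open Literature.AlgebraicGeometry.Hironaka2017.S02Preliminaries
open Literature.AlgebraicGeometry.Hironaka2017.Datum
open Scheme.IdealSheafData
open WildCones CampaignW46.AtomGerm

variable {p : ℕ} [Fact p.Prime] {K : Type} [Field K] [CharP K p] [IsAlgClosed K] {n : ℕ}

/-- [OURS · L1 W4.6, rung (i) for surfaces (`n = 1`), (ii)-type for all `n ≥ 1`; replaces the role of the termination
clause of Th. 16.13 p.87 l.25–28 («repeatedly but finitely many times») of H. Hironaka's ms. (2017) for the TYPED Th. 16.6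
procedure restricted to the forced-atom class IN ITS EXISTENTIAL FORM; NOT a statement of the manuscript] Over an
algebraically closed field `K` of characteristic `p`, `0 < n`: every regime of the typed procedure contained in the
existential forced-atom class (SOME presentation by an isolated atom at the singular point) is terminating. [folklore] -/
theorem terminates_of_le_forcedAtomExists (hn : 0 < n) {m : ℕ} (N : Notions.{0} m) (Rd : Reading p K N) (Rg : Regime p K)
    (hRg : ∀ (A : AmbientDatum p K) (E : IdealExponent A.Z), Rg A E →
      E.b = p ∧ E.sing.Subsingleton ∧ ∀ ξ ∈ E.sing,
        (maximalIdeal (A.Z.presheaf.stalk ξ)).spanFinrank = n + 1 ∧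
        ∃ (E₀ : AdicCompletion (maximalIdeal (A.Z.presheaf.stalk ξ)) (A.Z.presheaf.stalk ξ) ≃+*
            MvPowerSeries (Option (Fin n)) K)
          (f₀ : A.Z.presheaf.stalk ξ) (c₀ : (Fin n → ℕ) → K) (w₀ : MvPowerSeries (Option (Fin n)) K),
          stalkIdeal E.J ξ = Ideal.span {f₀} ∧ IsUnit w₀ ∧
            E₀ (algebraMap _ _ f₀) = w₀ * ((X none : MvPowerSeries (Option (Fin n)) K) ^ p -
              rename (some : Fin n → Option (Fin n)) (ser p n K c₀)) ∧ Isol p n K c₀) :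
    Terminates N Rd Rg :=
  haveI : PerfectRing K p := PerfectField.toPerfectRing p
  terminates_of_le_regime_forcedAtom (forcedAtomTerminates_holds hn m N Rd)
    fun A E h => Regime.forcedAtom_of_exists A E (hRg A E h)

/-- [OURS · L1 W4.6; NOT a statement of the manuscript] The ∇-centred form of `terminates_of_le_forcedAtomExists`: no
infinite ∇-centred run of the typed procedure in a regime contained in the existential forced-atom class (`K`
algebraically closed, `0 < n`). [folklore] -/
theorem terminatesNabla_of_le_forcedAtomExists (hn : 0 < n) {m : ℕ} (N : Notions.{0} m) (Rd : Reading p K N)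
    (Rg : Regime p K)
    (hRg : ∀ (A : AmbientDatum p K) (E : IdealExponent A.Z), Rg A E →
      E.b = p ∧ E.sing.Subsingleton ∧ ∀ ξ ∈ E.sing,
        (maximalIdeal (A.Z.presheaf.stalk ξ)).spanFinrank = n + 1 ∧
        ∃ (E₀ : AdicCompletion (maximalIdeal (A.Z.presheaf.stalk ξ)) (A.Z.presheaf.stalk ξ) ≃+*
            MvPowerSeries (Option (Fin n)) K)
          (f₀ : A.Z.presheaf.stalk ξ) (c₀ : (Fin n → ℕ) → K) (w₀ : MvPowerSeries (Option (Fin n)) K),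
          stalkIdeal E.J ξ = Ideal.span {f₀} ∧ IsUnit w₀ ∧
            E₀ (algebraMap _ _ f₀) = w₀ * ((X none : MvPowerSeries (Option (Fin n)) K) ^ p -
              rename (some : Fin n → Option (Fin n)) (ser p n K c₀)) ∧ Isol p n K c₀) :
    TerminatesNabla N Rd Rg :=
  terminatesNabla_of_terminates (terminates_of_le_forcedAtomExists hn N Rd Rg hRg)

end CampaignW46.ForcedAtom

end Summit.ResolutionOfSingularities.ResolutionOfSingularities.Theorems

end
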